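import Literature.MathematicalPhysics.QuantumFieldTheory.Balaban1983to89.Beta.ExpKernelCalculus

/-!
# `BalabanUV.Beta.D1BFx.FiniteStencilCalculus` — road «BF-x» for binder row D1, slot (SPLIT) ∕ leaf A1.ii, part 1 (generic): THE ONE-LOOP WORDS
# OF `ExpKernelCalculus` (`comp`, `tr`, `tadpole`, `bubble`) FOR FINITELY SUPPORTED STENCILS OVER AN ARBITRARY LEG ARE EXPLICIT FINITE SUMS —
# NO DECAY, NO SUMMABILITY HYPOTHESIS — and, over a fibre-diagonal translation-invariant leg, the bubble of two ELEMENTARY INSERTIONS is the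
# located-pair product `g(q′ − p)·g(q − p′)·Σ m m′` (the shape of an3's `GradedBubbles.term`)

HONEST DEPENDENCY (page 1, mandatory): continuum YM on T⁴ ⇐ BetaPertH ∧ nine spine estimates (0/9 proved); BetaPertH ⇐ (D1) ∧ (D4) ∧
CAP+tail; G-an2-4 gates asym, D1 and NE2/3/4.  HONEST FRAMING (cell contract, verbatim): «discharging `BetaPertH` makes Bałaban's UV
stability UNCONDITIONAL — a real constructive-QFT result; it is NOT the continuum limit and NOT the Clay problem.»  THIS MODULE DISCHARGES
NOTHING of the wall: [folklore] finite-support bookkeeping for `tsum`s (`tsum_eq_sum`) over the UNMODIFIED definitions of an2's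
`Beta.ExpKernelCalculus` (`comp`, `tr`, `tadpole`, `bubble`, imported BY NAME), plus ONE definition with a body ([our object] `elemK`, the
`ℤ^D`-kernel analogue of an2's torus `BubbleTable.elemIns`; asserts nothing).  No `Prop` is minted, nothing printed is asserted, 0 sorry.
0 wall binders instantiated; NOT D1, NOT `BetaPertH`, NOT continuum, NOT Clay.

ABSOLUTE RULE (cell charter, verbatim): «No internally-minted statement may enter as a cited fact. Every hypothesis is either kernel-proved in
this package or a verbatim quotation of a PUBLISHED theorem with page reference. The manuscript(s) under audit are NOT citable for their own
disputed steps — they are the thing under adjudication; programme-internal (2001/route/tribunal) claims are never citable.»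

WHY (skeleton v1.6 slot (SPLIT) = A0 ∘ A1.ii; `D1BFx/Assembly` header).  A1.ii — the road's located content — identifies the MAIN term of the
fine one-shot kernel with an3's realised background-field kernel `stK` (closed form `SpinTable.bfKernel`, `ℤ⁴` table currency
`GradedBubbles.bub` of `VecTableZ4.three_sectors_bf_Z4`).  The road's fine kernels are words of `ExpKernelCalculus` — `bubble (Ga n a) (S κ u) (S λ u′)`,
`tadpole (Ga n a) (Wf …)` — whose stencils `S κ u` (Wilson cubic `ffOf (wilsonA 3 κ u)`, the local Feynman completion, the ghost current) are
FINITELY SUPPORTED fine tables, while an3's tables are finite located-pair lists.  THIS FILE is the currency-neutral first step of the bridge: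
for finitely supported stencils every `tsum` in those words is a finite sum (§1–§3, ANY leg `A`, no hypothesis on `A`), and for the leg
`A x y a b = δ_{ab}·g(x − y)` the bubble of two elementary insertions is ONE located-pair product (§4) — letter for letter an3's
`GradedBubbles.term` at `trace(m m′) ↦ Σ_{a,f} m a f · m′ f a` (next parts: `realK` of a located-pair list and `bubble ∘ realK = GradedBubbles.bub`;
then the Wilson ∕ ghost stencils of the road as realised lists via an3's `WilsonStencilZ4`).

CONTENT (all [folklore]; `D` arbitrary, fibre `F` finite).
* §1 `comp` with a finitely supported factor: `comp_eq_sum_of_rowSupp` (right factor supported in rows `S`), `comp_eq_zero_of_colSupp_right`,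
  `comp_eq_sum_of_colSupp` (left factor supported in columns `T`), `comp_eq_zero_of_rowSupp_left`.
* §2 `tr` and `tadpole`: `tr_eq_sum_of_diagSupp`, **`tadpole_eq_sum`** (`tadpole A W = Σ_{x∈T} Σ_a Σ_{y∈S} Σ_f A x y a f · W y x f a`).
* §3 **`bubble_eq_sum`**: `bubble A V W = Σ_{x∈T_W} Σ_a Σ_{y∈T_V} Σ_f (Σ_{y₁∈S_V} Σ_{f₁} A x y₁ a f₁ · V y₁ y f₁ f) · (Σ_{y₂∈S_W} Σ_{f₂} A y y₂ f f₂ · W y₂ x f₂ a)`.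
* §4 [our object] `elemK p q m` (the insertion of the fibre matrix `m` at the located pair `(p, q)`), its support lemmas, **`bubble_elemK_elemK`**
  (any leg: `bubble A (elemK p q m) (elemK p′ q′ m′) = Σ_{a f f₁ f₂} A q′ p a f₁ · m f₁ f · A q p′ f f₂ · m′ f₂ a`), **`tadpole_elemK`**, and over the
  fibre-diagonal translation-invariant leg **`bubble_elemK_elemK_diag`**: `= g (q′ − p) · g (q − p′) · Σ_{a f} m a f · m′ f a`.
Unit `b2b-balaban-beta-d1-p2` (road owner, gen 2); `LEAVES-BFx.md` row A1.ii (part 1, generic).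
-/

open Finset
open scoped BigOperators
open Literature.MathematicalPhysics.QuantumFieldTheory.Balaban1983to89.Beta
open ExpKernelCalculus (Site MKer comp tr bubble tadpole)

namespace Summit.QuantumFields.BalabanUV.Beta.D1BFx.FiniteStencilCalculus

variable {D : ℕ} {F : Type*} [Fintype F]

/-! ## §1 `comp` with a finitely supported factor -/

section Comp

/-- [folklore] **RIGHT FACTOR SUPPORTED IN THE ROWS `S`**: `comp A V x z a b = Σ_{y∈S} Σ_f A x y a f · V y z f b` — the `tsum` is a finite sum. -/
theorem comp_eq_sum_of_rowSupp (A V : MKer D F) {S : Finset (Site D)} (hV : ∀ y z f b, y ∉ S → V y z f b = 0)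
    (x z : Site D) (a b : F) :
    comp A V x z a b = ∑ y ∈ S, ∑ f, A x y a f * V y z f b := by
  unfold comp
  exact tsum_eq_sum fun y hy => sum_eq_zero fun f _ => by rw [hV y z f b hy, mul_zero]

/-- [folklore] **RIGHT FACTOR SUPPORTED IN THE COLUMNS `T`**: `comp A V x z = 0` for `z ∉ T`. -/
theorem comp_eq_zero_of_colSupp_right (A V : MKer D F) {T : Finset (Site D)} (hV : ∀ y z f b, z ∉ T → V y z f b = 0)
    (x z : Site D) (hz : z ∉ T) (a b : F) :
    comp A V x z a b = 0 := by
  unfold comp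
  rw [tsum_congr (fun y => sum_eq_zero fun f _ => by rw [hV y z f b hz, mul_zero])]
  exact tsum_zero

/-- [folklore] **LEFT FACTOR SUPPORTED IN THE COLUMNS `T`**: `comp V A x z a b = Σ_{y∈T} Σ_f V x y a f · A y z f b`. -/
theorem comp_eq_sum_of_colSupp (V A : MKer D F) {T : Finset (Site D)} (hV : ∀ x y a f, y ∉ T → V x y a f = 0)
    (x z : Site D) (a b : F) :
    comp V A x z a b = ∑ y ∈ T, ∑ f, V x y a f * A y z f b := by
  unfold comp
  exact tsum_eq_sum fun y hy => sum_eq_zero fun f _ => by rw [hV x y a f hy, zero_mul]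

/-- [folklore] **LEFT FACTOR SUPPORTED IN THE ROWS `S`**: `comp V A x z = 0` for `x ∉ S`. -/
theorem comp_eq_zero_of_rowSupp_left (V A : MKer D F) {S : Finset (Site D)} (hV : ∀ x y a f, x ∉ S → V x y a f = 0)
    (x z : Site D) (hx : x ∉ S) (a b : F) :
    comp V A x z a b = 0 := by
  unfold comp
  rw [tsum_congr (fun y => sum_eq_zero fun f _ => by rw [hV x y a f hx, zero_mul])]
  exact tsum_zero

end Comp

/-! ## §2 `tr` and `tadpole` -/

section Trace

/-- [folklore] **TRACE OF A KERNEL WITH FINITELY SUPPORTED DIAGONAL**: `tr K = Σ_{x∈S} Σ_a K x x a a`. -/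
theorem tr_eq_sum_of_diagSupp (K : MKer D F) {S : Finset (Site D)} (hK : ∀ x a, x ∉ S → K x x a a = 0) :
    tr K = ∑ x ∈ S, ∑ a, K x x a a := by
  unfold tr
  exact tsum_eq_sum fun x hx => sum_eq_zero fun a _ => hK x a hx

/-- [folklore] **THE TADPOLE OF A FINITELY SUPPORTED TABLE OVER ANY LEG IS A FINITE SUM**: for `W` supported in rows `S` and columns `T`,
`tadpole A W = Σ_{x∈T} Σ_a Σ_{y∈S} Σ_f A x y a f · W y x f a` — no hypothesis on the leg `A`. -/
theorem tadpole_eq_sum (A W : MKer D F) {S T : Finset (Site D)} (hS : ∀ y z f b, y ∉ S → W y z f b = 0)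
    (hT : ∀ y z f b, z ∉ T → W y z f b = 0) :
    tadpole A W = ∑ x ∈ T, ∑ a, ∑ y ∈ S, ∑ f, A x y a f * W y x f a := by
  unfold tadpole
  rw [tr_eq_sum_of_diagSupp (comp A W) (S := T) (fun x a hx => comp_eq_zero_of_colSupp_right A W hT x x hx a a)]
  exact sum_congr rfl fun x _ => sum_congr rfl fun a _ => comp_eq_sum_of_rowSupp A W hS x x a a

end Trace

/-! ## §3 `bubble` -/

section Bubble

/-- [folklore] **THE BUBBLE OF TWO FINITELY SUPPORTED STENCILS OVER ANY LEG IS A FINITE SUM**: for `V` supported in rows `S₁` / columns `T₁` and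
`W` in rows `S₂` / columns `T₂`,
`bubble A V W = Σ_{x∈T₂} Σ_a Σ_{y∈T₁} Σ_f (Σ_{y₁∈S₁} Σ_{f₁} A x y₁ a f₁ · V y₁ y f₁ f) · (Σ_{y₂∈S₂} Σ_{f₂} A y y₂ f f₂ · W y₂ x f₂ a)` — no hypothesis on `A`. -/
theorem bubble_eq_sum (A V W : MKer D F) {S₁ T₁ S₂ T₂ : Finset (Site D)}
    (hS₁ : ∀ y z f b, y ∉ S₁ → V y z f b = 0) (hT₁ : ∀ y z f b, z ∉ T₁ → V y z f b = 0)
    (hS₂ : ∀ y z f b, y ∉ S₂ → W y z f b = 0) (hT₂ : ∀ y z f b, z ∉ T₂ → W y z f b = 0) :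
    bubble A V W = ∑ x ∈ T₂, ∑ a, ∑ y ∈ T₁, ∑ f,
      (∑ y₁ ∈ S₁, ∑ f₁, A x y₁ a f₁ * V y₁ y f₁ f) * (∑ y₂ ∈ S₂, ∑ f₂, A y y₂ f f₂ * W y₂ x f₂ a) := by
  unfold bubble
  -- the outer factor `comp A W` is supported in the columns `T₂`, so the trace is a sum over `T₂`
  have hcolW : ∀ x y a f, y ∉ T₂ → comp A W x y a f = 0 := fun x y a f hy => comp_eq_zero_of_colSupp_right A W hT₂ x y hy a f
  have hcolV : ∀ x y a f, y ∉ T₁ → comp A V x y a f = 0 := fun x y a f hy => comp_eq_zero_of_colSupp_right A V hT₁ x y hy a f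
  have hdiag : ∀ x a, x ∉ T₂ → comp (comp A V) (comp A W) x x a a = 0 := fun x a hx =>
    comp_eq_zero_of_colSupp_right (comp A V) (comp A W) hcolW x x hx a a
  rw [tr_eq_sum_of_diagSupp _ hdiag]
  refine sum_congr rfl fun x _ => sum_congr rfl fun a _ => ?_
  rw [comp_eq_sum_of_colSupp (comp A V) (comp A W) hcolV x x a a]
  refine sum_congr rfl fun y _ => sum_congr rfl fun f _ => ?_
  rw [comp_eq_sum_of_rowSupp A V hS₁ x y a f, comp_eq_sum_of_rowSupp A W hS₂ y x f a]

end Bubble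

/-! ## §4 Elementary insertions -/

section Elem

/-- [our object] **THE ELEMENTARY INSERTION** of the fibre matrix `m` at the located pair `(p, q)`: the kernel `x z a b ↦ m a b` if `(x, z) = (p, q)`,
else `0` (the `ℤ^D`-kernel analogue of an2's torus `BubbleTable.elemIns`).  A DEFINITION; asserts nothing. -/
def elemK (p q : Site D) (m : F → F → ℝ) : MKer D F := fun x z a b => if x = p ∧ z = q then m a b else 0

omit [Fintype F] in
/-- [our object] Unfolding. -/
theorem elemK_apply (p q : Site D) (m : F → F → ℝ) (x z : Site D) (a b : F) :
    elemK p q m x z a b = if x = p ∧ z = q then m a b else 0 := rfl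

omit [Fintype F] in
/-- [our object] The value at the located pair. -/
@[simp] theorem elemK_self (p q : Site D) (m : F → F → ℝ) (a b : F) : elemK p q m p q a b = m a b := by
  simp [elemK]

omit [Fintype F] in
/-- [folklore] Row support `{p}`. -/
theorem elemK_rowSupp (p q : Site D) (m : F → F → ℝ) : ∀ y z f b, y ∉ ({p} : Finset (Site D)) → elemK p q m y z f b = 0 := by
  intro y z f b hy
  rw [mem_singleton] at hy
  simp [elemK, hy]

omit [Fintype F] in
/-- [folklore] Column support `{q}`. -/
theorem elemK_colSupp (p q : Site D) (m : F → F → ℝ) : ∀ y z f b, z ∉ ({q} : Finset (Site D)) → elemK p q m y z f b = 0 := by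
  intro y z f b hz
  rw [mem_singleton] at hz
  simp [elemK, hz]

/-- [folklore] **THE TADPOLE OF AN ELEMENTARY INSERTION OVER ANY LEG**: `tadpole A (elemK p q m) = Σ_{a f} A q p a f · m f a`. -/
theorem tadpole_elemK (A : MKer D F) (p q : Site D) (m : F → F → ℝ) :
    tadpole A (elemK p q m) = ∑ a, ∑ f, A q p a f * m f a := by
  rw [tadpole_eq_sum A (elemK p q m) (elemK_rowSupp p q m) (elemK_colSupp p q m), sum_singleton]
  refine sum_congr rfl fun a _ => ?_
  rw [sum_singleton]
  exact sum_congr rfl fun f _ => by rw [elemK_self]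

/-- [folklore] **THE BUBBLE OF TWO ELEMENTARY INSERTIONS OVER ANY LEG**:
`bubble A (elemK p q m) (elemK p′ q′ m′) = Σ_a Σ_f (Σ_{f₁} A q′ p a f₁ · m f₁ f) · (Σ_{f₂} A q p′ f f₂ · m′ f₂ a)` — one leg entry `A q′ p`
(from the second insertion's column back to the first's row) and one `A q p′`. -/
theorem bubble_elemK_elemK (A : MKer D F) (p q p' q' : Site D) (m m' : F → F → ℝ) :
    bubble A (elemK p q m) (elemK p' q' m') =
      ∑ a, ∑ f, (∑ f₁, A q' p a f₁ * m f₁ f) * (∑ f₂, A q p' f f₂ * m' f₂ a) := by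
  rw [bubble_eq_sum A (elemK p q m) (elemK p' q' m') (elemK_rowSupp p q m) (elemK_colSupp p q m) (elemK_rowSupp p' q' m')
      (elemK_colSupp p' q' m'), sum_singleton]
  refine sum_congr rfl fun a _ => ?_
  rw [sum_singleton]
  refine sum_congr rfl fun f _ => ?_
  rw [sum_singleton, sum_singleton]
  simp only [elemK_self]

/-- [folklore] **OVER A FIBRE-DIAGONAL TRANSLATION-INVARIANT LEG** `A x y a b = δ_{ab}·g (x − y)` the bubble of two elementary insertions is ONE
located-pair product: `bubble A (elemK p q m) (elemK p′ q′ m′) = g (q′ − p) · g (q − p′) · Σ_a Σ_f m a f · m′ f a` — the shape of an3's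
`GradedBubbles.term` (`trace(m m′)·g(·)·g(·)`), with the trace written as the explicit double sum. -/
theorem bubble_elemK_elemK_diag [DecidableEq F] (g : Site D → ℝ) {A : MKer D F} (hA : ∀ x y a b, A x y a b = if a = b then g (x - y) else 0)
    (p q p' q' : Site D) (m m' : F → F → ℝ) :
    bubble A (elemK p q m) (elemK p' q' m') = g (q' - p) * g (q - p') * ∑ a, ∑ f, m a f * m' f a := by
  rw [bubble_elemK_elemK, mul_sum]
  refine sum_congr rfl fun a _ => ?_
  rw [mul_sum]
  refine sum_congr rfl fun f _ => ?_
  have h1 : ∑ f₁, A q' p a f₁ * m f₁ f = g (q' - p) * m a f := by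
    rw [sum_eq_single a (fun f₁ _ hf₁ => by rw [hA, if_neg (Ne.symm hf₁), zero_mul]) (fun h => absurd (mem_univ a) h), hA, if_pos rfl]
  have h2 : ∑ f₂, A q p' f f₂ * m' f₂ a = g (q - p') * m' f a := by
    rw [sum_eq_single f (fun f₂ _ hf₂ => by rw [hA, if_neg (Ne.symm hf₂), zero_mul]) (fun h => absurd (mem_univ f) h), hA, if_pos rfl]
  rw [h1, h2]
  ring

/-- [folklore] The same over the leg `A x y a b = δ_{ab}·g (x − y)` for the tadpole: `tadpole A (elemK p q m) = g (q − p) · Σ_a m a a`. -/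
theorem tadpole_elemK_diag [DecidableEq F] (g : Site D → ℝ) {A : MKer D F} (hA : ∀ x y a b, A x y a b = if a = b then g (x - y) else 0)
    (p q : Site D) (m : F → F → ℝ) :
    tadpole A (elemK p q m) = g (q - p) * ∑ a, m a a := by
  rw [tadpole_elemK, mul_sum]
  refine sum_congr rfl fun a _ => ?_
  rw [sum_eq_single a (fun f _ hf => by rw [hA, if_neg (Ne.symm hf), zero_mul]) (fun h => absurd (mem_univ a) h), hA, if_pos rfl]

end Elem

end Summit.QuantumFields.BalabanUV.Beta.D1BFx.FiniteStencilCalculus
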